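import Summits.QuantumFields.YangMills.Theorems.BalabanUVNodesN21CollarJunctionLowCentre
import Summits.QuantumFields.YangMills.Theorems.BalabanUVNodesN21ProjectedCentreNonCollapse

/-!
# N21 (NE7c) · THE DOUBLY-DISCHARGED COLLAR JUNCTION ON THE PROJECTED-CENTRE ROAD: (M1) on the cut law with
# non-collapse FROM quadratic domination with obtuse cross terms, the odds FROM the collar's letters, the envelope
# SPLIT LETTERWISE

R141 (C) seat pub-ymgap-dag-n21-e (g16), node N21 = NE7c (single-run shell-weight bound, NOT PRINTED in [Bałaban
1983–89], NOT proved), strategy s3 ALTERNATIVE CURRENCY, lane K3⁷ `SpineGivenEndpointR13SepCoPH`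
(stmt-QuantumFields-20544, `--kind proof --supports … --as helper`).  Part 38n of this seat's series — the twin of 38m
`…N21CollarJunctionLowCentre` (p579137) on n21-d's projected-centre road: consumes n21-d part 32
`…N21ProjectedCentreNonCollapse` (p578555; mathematics = lens v29.0 ROW P‴, `hmono_of_projectedCentre`) BY NAME, 38l §3
`slotAntiConcentration_restrict_of_recentredDilation_collar` and 38m §1 ∕ §2.  (Part 34
`…N21ProjectedCentreDilation.slotAntiConcentration_restrict_of_projectedCentre` keeps `hQ` and `henv` as binders; the
corollary was offered to n21-d twice, bus l.23757 ∕ l.23863 ∕ l.24016, and met silence.)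

WHAT.  In the product frame `X × (κ → ℝ)` with the density
`𝟙_{K p.1}(p.2)·exp(−(½⟨p.2 − m p.1, A(p.2 − m p.1)⟩ + P p.1 p.2))` — `m z` the linear Gaussian centre, `A` symmetric
with `γ‖x‖² ≤ ⟨x, Ax⟩`, `P z` `G`-Lipschitz on the kept convex cut `K z` (NO convexity of the block action) — and the
dilation about a centre `c z ∈ K z` with OBTUSE cross terms at the shell ∩ cut points and `2G∕γ`-FAR from the shell:
* §1 ★★ `slotAntiConcentration_restrict_of_projectedCentre_collar`: P2 with `hmono` from part 32
  `hmono_of_projectedCentre` AND `hQ` from 38l §1 (via 38l §3 BY NAME), cut event `C := C⋆ ∩ ⋂ᵢ {q.2 i ∈ P₁ i}`,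
  envelope `(⋂ᵢ {q.2 i ∈ E₁ i}) ∩ ({U<θ} ∩ C⋆)`, constant `3(#κ+1)·∏ᵢ(1+Qᵢ)∕(κ₀(1−ρ))`; displayed binders: `hobt`,
  `hfar`, `henv`, `hRT`, `hodds`;
* ★★★ `slotAntiConcentration_restrict_of_projectedCentre_letterwise`: the same with `henv` from 38m §2
  `henv_of_letterwise` (per-letter image clauses about `c` + the core clause);
* §2 A6 witness `collarJunctionProjectedCentre_binders_inhabited` (director-ym STANDING A6 RULE №189 (3)): ★★★ APPLIED
  with EVERY binder discharged in the kernel — one-point exterior, block `ℝ²`, kept cut `K = {|w₁| < 1}`, `A = 1`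
  (coercive with `γ = ½` for the sup norm: `sup_sq_le_two_dot`), `P = 0` (`G = 0`), `m = c = 0`, statistic
  `U = |w₁|`, `θ = 1`, `ρ = ½`, `κ₀ = 1`, letter `(−1, 1) ⊂ (−7∕6, 7∕6)` on coordinate `0` (odds transported under `K`
  by 38m §1 from 38l §2's Gaussian species, after `quadForm_one_eq_gaussian` identifies the density).

HONEST FRAMING.  [textbook] composition + real arithmetic; 0 def, 0 sorry; coercivity `γ`, the Lipschitz bound `G`,
obtuseness, farness, transversality, slopes, shells, thresholds, the centres `m`, `c` and the not-read structure are
HYPOTHESES (n21-d parts 19 ∕ 27 ∕ 32 ∕ 33, NODE O's term object, lens Cards 80–88's located numbers — none asserted);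
nothing of Bałaban's asserted; NE7c NOT PRINTED ∕ NOT proved; N21 NOT discharged; counts unmoved (typed 28∕28 ·
discharged 5∕27); count-neutral; one finite 𝕋⁴ at fixed ε — nothing about ℝ⁴ ∕ OS ∕ mass gap ∕ Clay.
-/

set_option autoImplicit false

open MeasureTheory Set Function Matrix
open scoped ENNReal

namespace Summit.QuantumFields.YangMills.Theorems.N21CollarJunctionProjectedCentre

open Literature.MathematicalPhysics.QuantumFieldTheory.Balaban1983to89.T4ShellMeasure (SlotAntiConcentration)
open Summit.QuantumFields.YangMills.Theorems.N21CollarOddsBlockFrame (isFiniteMeasure_blockGaussianWeight)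
open Summit.QuantumFields.YangMills.Theorems.N21CollarLetterOdds (gaussianBlock_inwardSlopes)
open Summit.QuantumFields.YangMills.Theorems.N21CollarEnvelopeOdds
  (hodds_absLetter_of_partialSlopes slotAntiConcentration_restrict_of_recentredDilation_collar)
open Summit.QuantumFields.YangMills.Theorems.N21ProjectedCentreNonCollapse (hmono_of_projectedCentre)
open Summit.QuantumFields.YangMills.Theorems.N21CollarJunctionLowCentre

variable {X : Type*} [MeasurableSpace X] {κ : Type*} [Fintype κ] [DecidableEq κ]

/-! ## §1 The doubly-discharged junction on the projected-centre road -/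

section Junction

/-- **★★ THE JUNCTION ON THE PROJECTED-CENTRE ROAD, `hmono` AND `hQ` DISCHARGED.**  Part 34's setting (density
`𝟙_{K p.1}(p.2)·exp(−(½⟨p.2 − m p.1, A(p.2 − m p.1)⟩ + P p.1 p.2))`, `A` symmetric and `γ`-coercive, `P z` `G`-Lipschitz
on the convex kept cut `K z`, dilation centre `c z ∈ K z`, obtuse cross terms and `2G∕γ`-farness at the shell ∩ cut)
with the cut event split as `C := C⋆ ∩ ⋂_{i∈M} {q.2 i ∈ P₁ i}` and the envelope `(⋂_{i∈M} {q.2 i ∈ E₁ i}) ∩ ({U<θ} ∩ C⋆)`;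
`U`, `C⋆` read no collar coordinate; per-coordinate conditional odds `Qᵢ`.  Then P2 holds with `hmono` supplied by part
32 `hmono_of_projectedCentre` and `hQ` by 38l §1 (through 38l §3 BY NAME):
`SlotAntiConcentration (ν|({U<θ} ∩ C)) U θ ρ (3(#κ+1)·∏ᵢ(1+Qᵢ)∕(κ₀(1−ρ)))`. [textbook] -/
theorem slotAntiConcentration_restrict_of_projectedCentre_collar [Nonempty κ] (ζ : Measure X) [SFinite ζ]
    (K : X → Set (κ → ℝ)) (A : Matrix κ κ ℝ) (hA : A.IsSymm) {γ G : ℝ} (hγ0 : 0 < γ)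
    (hγ : ∀ x : κ → ℝ, γ * ‖x‖ ^ 2 ≤ x ⬝ᵥ (A *ᵥ x))
    (m : X → (κ → ℝ)) {c : X → (κ → ℝ)} (hc : Measurable c) (P : X → (κ → ℝ) → ℝ)
    (hg : Measurable fun p : X × (κ → ℝ) => (K p.1).indicator (fun w => ENNReal.ofReal (Real.exp
      (-(1 / 2 * ((w - m p.1) ⬝ᵥ (A *ᵥ (w - m p.1))) + P p.1 w)))) p.2)
    [IsFiniteMeasure ((ζ.prod volume).withDensity fun p : X × (κ → ℝ) => (K p.1).indicator (fun w =>
      ENNReal.ofReal (Real.exp (-(1 / 2 * ((w - m p.1) ⬝ᵥ (A *ᵥ (w - m p.1))) + P p.1 w)))) p.2)]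
    {U : X × (κ → ℝ) → ℝ} (hUm : Measurable U)
    {Cstar : Set (X × (κ → ℝ))} (hCstar : MeasurableSet Cstar)
    (M : Finset κ) (P₁ E₁ : κ → Set ℝ) (hP₁ : ∀ i ∈ M, MeasurableSet (P₁ i))
    (hE₁ : ∀ i ∈ M, MeasurableSet (E₁ i)) (hPE : ∀ i ∈ M, P₁ i ⊆ E₁ i) (Q : κ → ℝ) (hQ0 : ∀ i ∈ M, 0 ≤ Q i)
    (hodds : ∀ i ∈ M, ∀ C : Set (X × (κ → ℝ)), MeasurableSet C →
      (∀ (z : X) (w : κ → ℝ) (y : ℝ), (z, update w i y) ∈ C ↔ (z, w) ∈ C) →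
      ((ζ.prod volume).withDensity fun p : X × (κ → ℝ) => (K p.1).indicator (fun w => ENNReal.ofReal (Real.exp
          (-(1 / 2 * ((w - m p.1) ⬝ᵥ (A *ᵥ (w - m p.1))) + P p.1 w)))) p.2)
          (({q | q.2 i ∈ E₁ i} \ {q | q.2 i ∈ P₁ i}) ∩ C)
        ≤ ENNReal.ofReal (Q i) *
          ((ζ.prod volume).withDensity fun p : X × (κ → ℝ) => (K p.1).indicator (fun w => ENNReal.ofReal (Real.exp
            (-(1 / 2 * ((w - m p.1) ⬝ᵥ (A *ᵥ (w - m p.1))) + P p.1 w)))) p.2) ({q | q.2 i ∈ P₁ i} ∩ C))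
    (hUi : ∀ i ∈ M, ∀ (z : X) (w : κ → ℝ) (y : ℝ), U (z, update w i y) = U (z, w))
    (hCi : ∀ i ∈ M, ∀ (z : X) (w : κ → ℝ) (y : ℝ), (z, update w i y) ∈ Cstar ↔ (z, w) ∈ Cstar)
    {θ ρ κ₀ : ℝ} (hθ : 0 < θ) (hρ0 : 0 < ρ) (hρ1 : ρ < 1) (hκ : 0 < κ₀)
    (hK : ∀ z, Convex ℝ (K z)) (hcK : ∀ z, c z ∈ K z)
    (hP : ∀ z, ∀ v ∈ K z, ∀ v' ∈ K z, P z v - P z v' ≤ G * ‖v - v'‖)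
    (hobt : ∀ p : X × (κ → ℝ), θ * (1 - ρ) ≤ U p → U p < θ →
      p ∈ Cstar ∩ ⋂ i ∈ M, {q : X × (κ → ℝ) | q.2 i ∈ P₁ i} → p.2 ∈ K p.1 →
        0 ≤ (c p.1 - m p.1) ⬝ᵥ (A *ᵥ (p.2 - c p.1)))
    (hfar : ∀ p : X × (κ → ℝ), θ * (1 - ρ) ≤ U p → U p < θ →
      p ∈ Cstar ∩ ⋂ i ∈ M, {q : X × (κ → ℝ) | q.2 i ∈ P₁ i} → p.2 ∈ K p.1 → 2 * G ≤ γ * ‖p.2 - c p.1‖)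
    (henv : ∀ l ∈ Icc (1 - 1 / ((Fintype.card κ : ℝ) + 1)) 1, ∀ p : X × (κ → ℝ),
      θ * (1 - ρ) ≤ U p → U p < θ → p ∈ Cstar ∩ ⋂ i ∈ M, {q : X × (κ → ℝ) | q.2 i ∈ P₁ i} →
        (p.1, c p.1 + l • (p.2 - c p.1))
          ∈ (⋂ i ∈ M, {q : X × (κ → ℝ) | q.2 i ∈ E₁ i}) ∩ ({q | U q < θ} ∩ Cstar))
    (hRT : ∀ p : X × (κ → ℝ), θ * (1 - ρ) ≤ U p → U p < θ →
      p ∈ Cstar ∩ ⋂ i ∈ M, {q : X × (κ → ℝ) | q.2 i ∈ P₁ i} → ∀ s : ℝ, 1 ≤ s →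
      θ * (1 - ρ) ≤ U (p.1, c p.1 + s • (p.2 - c p.1)) → U (p.1, c p.1 + s • (p.2 - c p.1)) < θ →
        (p.1, c p.1 + s • (p.2 - c p.1)) ∈ Cstar ∩ ⋂ i ∈ M, {q : X × (κ → ℝ) | q.2 i ∈ P₁ i} →
          U p + κ₀ * (θ * (1 - ρ)) * (s - 1) ≤ U (p.1, c p.1 + s • (p.2 - c p.1))) :
    SlotAntiConcentration
      (((ζ.prod volume).withDensity fun p : X × (κ → ℝ) => (K p.1).indicator (fun w => ENNReal.ofReal (Real.exp
          (-(1 / 2 * ((w - m p.1) ⬝ᵥ (A *ᵥ (w - m p.1))) + P p.1 w)))) p.2).restrict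
        ({p | U p < θ} ∩ (Cstar ∩ ⋂ i ∈ M, {q : X × (κ → ℝ) | q.2 i ∈ P₁ i}))) U θ ρ
      (3 * ((Fintype.card κ : ℝ) + 1) * (∏ i ∈ M, (1 + Q i)) / (κ₀ * (1 - ρ))) := by
  have hl₀ : 0 ≤ 1 - 1 / ((Fintype.card κ : ℝ) + 1) := by
    rw [sub_nonneg, div_le_one (by positivity)]
    linarith [show (0 : ℝ) ≤ Fintype.card κ from Nat.cast_nonneg _]
  exact slotAntiConcentration_restrict_of_recentredDilation_collar ζ hc hg hUm hCstar M P₁ E₁ hP₁ hE₁ hPE Q hQ0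
    hodds hUi hCi hθ hρ0 hρ1 hκ henv
    (hmono_of_projectedCentre K A hA hγ0 hγ m c P U (Cstar ∩ ⋂ i ∈ M, {q : X × (κ → ℝ) | q.2 i ∈ P₁ i})
      hl₀ hK hcK hP hobt hfar) hRT

/-- **★★★ THE JUNCTION ON THE PROJECTED-CENTRE ROAD WITH THE ENVELOPE SPLIT LETTERWISE** — P2 with `hmono` (part
32), `hQ` (38l §1) AND `henv` (38m §2 `henv_of_letterwise`, about the centre `c`) discharged.  Displayed binders:
obtuseness `hobt`, farness `hfar`, radial transversality `hRT`, per-letter image clauses `hletter` (38m §2's species,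
from a bound on the centre's collar coordinates), the core clause `hcore` (38m §2 `hcore_of_starConvex`), and the
per-coordinate odds `hodds` (38l §2 under the cuts by 38m §1). [textbook] -/
theorem slotAntiConcentration_restrict_of_projectedCentre_letterwise [Nonempty κ] (ζ : Measure X) [SFinite ζ]
    (K : X → Set (κ → ℝ)) (A : Matrix κ κ ℝ) (hA : A.IsSymm) {γ G : ℝ} (hγ0 : 0 < γ)
    (hγ : ∀ x : κ → ℝ, γ * ‖x‖ ^ 2 ≤ x ⬝ᵥ (A *ᵥ x))
    (m : X → (κ → ℝ)) {c : X → (κ → ℝ)} (hc : Measurable c) (P : X → (κ → ℝ) → ℝ)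
    (hg : Measurable fun p : X × (κ → ℝ) => (K p.1).indicator (fun w => ENNReal.ofReal (Real.exp
      (-(1 / 2 * ((w - m p.1) ⬝ᵥ (A *ᵥ (w - m p.1))) + P p.1 w)))) p.2)
    [IsFiniteMeasure ((ζ.prod volume).withDensity fun p : X × (κ → ℝ) => (K p.1).indicator (fun w =>
      ENNReal.ofReal (Real.exp (-(1 / 2 * ((w - m p.1) ⬝ᵥ (A *ᵥ (w - m p.1))) + P p.1 w)))) p.2)]
    {U : X × (κ → ℝ) → ℝ} (hUm : Measurable U)
    {Cstar : Set (X × (κ → ℝ))} (hCstar : MeasurableSet Cstar)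
    (M : Finset κ) (P₁ E₁ : κ → Set ℝ) (hP₁ : ∀ i ∈ M, MeasurableSet (P₁ i))
    (hE₁ : ∀ i ∈ M, MeasurableSet (E₁ i)) (hPE : ∀ i ∈ M, P₁ i ⊆ E₁ i) (Q : κ → ℝ) (hQ0 : ∀ i ∈ M, 0 ≤ Q i)
    (hodds : ∀ i ∈ M, ∀ C : Set (X × (κ → ℝ)), MeasurableSet C →
      (∀ (z : X) (w : κ → ℝ) (y : ℝ), (z, update w i y) ∈ C ↔ (z, w) ∈ C) →
      ((ζ.prod volume).withDensity fun p : X × (κ → ℝ) => (K p.1).indicator (fun w => ENNReal.ofReal (Real.exp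
          (-(1 / 2 * ((w - m p.1) ⬝ᵥ (A *ᵥ (w - m p.1))) + P p.1 w)))) p.2)
          (({q | q.2 i ∈ E₁ i} \ {q | q.2 i ∈ P₁ i}) ∩ C)
        ≤ ENNReal.ofReal (Q i) *
          ((ζ.prod volume).withDensity fun p : X × (κ → ℝ) => (K p.1).indicator (fun w => ENNReal.ofReal (Real.exp
            (-(1 / 2 * ((w - m p.1) ⬝ᵥ (A *ᵥ (w - m p.1))) + P p.1 w)))) p.2) ({q | q.2 i ∈ P₁ i} ∩ C))
    (hUi : ∀ i ∈ M, ∀ (z : X) (w : κ → ℝ) (y : ℝ), U (z, update w i y) = U (z, w))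
    (hCi : ∀ i ∈ M, ∀ (z : X) (w : κ → ℝ) (y : ℝ), (z, update w i y) ∈ Cstar ↔ (z, w) ∈ Cstar)
    {θ ρ κ₀ : ℝ} (hθ : 0 < θ) (hρ0 : 0 < ρ) (hρ1 : ρ < 1) (hκ : 0 < κ₀)
    (hK : ∀ z, Convex ℝ (K z)) (hcK : ∀ z, c z ∈ K z)
    (hP : ∀ z, ∀ v ∈ K z, ∀ v' ∈ K z, P z v - P z v' ≤ G * ‖v - v'‖)
    (hobt : ∀ p : X × (κ → ℝ), θ * (1 - ρ) ≤ U p → U p < θ →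
      p ∈ Cstar ∩ ⋂ i ∈ M, {q : X × (κ → ℝ) | q.2 i ∈ P₁ i} → p.2 ∈ K p.1 →
        0 ≤ (c p.1 - m p.1) ⬝ᵥ (A *ᵥ (p.2 - c p.1)))
    (hfar : ∀ p : X × (κ → ℝ), θ * (1 - ρ) ≤ U p → U p < θ →
      p ∈ Cstar ∩ ⋂ i ∈ M, {q : X × (κ → ℝ) | q.2 i ∈ P₁ i} → p.2 ∈ K p.1 → 2 * G ≤ γ * ‖p.2 - c p.1‖)
    (hletter : ∀ i ∈ M, ∀ l ∈ Icc (1 - 1 / ((Fintype.card κ : ℝ) + 1)) 1, ∀ (z : X) (w : κ → ℝ),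
      w i ∈ P₁ i → (c z + l • (w - c z)) i ∈ E₁ i)
    (hcore : ∀ l ∈ Icc (1 - 1 / ((Fintype.card κ : ℝ) + 1)) 1, ∀ p : X × (κ → ℝ),
      θ * (1 - ρ) ≤ U p → U p < θ → p ∈ Cstar →
        (p.1, c p.1 + l • (p.2 - c p.1)) ∈ {q : X × (κ → ℝ) | U q < θ} ∩ Cstar)
    (hRT : ∀ p : X × (κ → ℝ), θ * (1 - ρ) ≤ U p → U p < θ →
      p ∈ Cstar ∩ ⋂ i ∈ M, {q : X × (κ → ℝ) | q.2 i ∈ P₁ i} → ∀ s : ℝ, 1 ≤ s →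
      θ * (1 - ρ) ≤ U (p.1, c p.1 + s • (p.2 - c p.1)) → U (p.1, c p.1 + s • (p.2 - c p.1)) < θ →
        (p.1, c p.1 + s • (p.2 - c p.1)) ∈ Cstar ∩ ⋂ i ∈ M, {q : X × (κ → ℝ) | q.2 i ∈ P₁ i} →
          U p + κ₀ * (θ * (1 - ρ)) * (s - 1) ≤ U (p.1, c p.1 + s • (p.2 - c p.1))) :
    SlotAntiConcentration
      (((ζ.prod volume).withDensity fun p : X × (κ → ℝ) => (K p.1).indicator (fun w => ENNReal.ofReal (Real.exp
          (-(1 / 2 * ((w - m p.1) ⬝ᵥ (A *ᵥ (w - m p.1))) + P p.1 w)))) p.2).restrict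
        ({p | U p < θ} ∩ (Cstar ∩ ⋂ i ∈ M, {q : X × (κ → ℝ) | q.2 i ∈ P₁ i}))) U θ ρ
      (3 * ((Fintype.card κ : ℝ) + 1) * (∏ i ∈ M, (1 + Q i)) / (κ₀ * (1 - ρ))) :=
  slotAntiConcentration_restrict_of_projectedCentre_collar ζ K A hA hγ0 hγ m hc P hg hUm hCstar M P₁ E₁ hP₁ hE₁
    hPE Q hQ0 hodds hUi hCi hθ hρ0 hρ1 hκ hK hcK hP hobt hfar (henv_of_letterwise c U Cstar M P₁ E₁ hletter hcore)
    hRT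

end Junction

/-! ## §2 A6 witness: every binder of the ★★★ END is jointly inhabited -/

section Witness

/-- with `A = 1`, `m = 0`, `P = 0` the quadratic block action is the Gaussian potential of 38j ∕ 38k ∕ 38m′.
[textbook] -/
theorem quadForm_one_eq_gaussian (w : Fin 2 → ℝ) :
    1 / 2 * ((w - 0) ⬝ᵥ ((1 : Matrix (Fin 2) (Fin 2) ℝ) *ᵥ (w - 0))) + (0 : ℝ) = ∑ i, w i ^ 2 / 2 := by
  simp only [sub_zero, Matrix.one_mulVec, add_zero, dotProduct, Finset.mul_sum]
  exact Finset.sum_congr rfl fun i _ => by ring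

/-- the identity is `½`-coercive for the SUP norm on `ℝ²`: `½‖x‖² ≤ ⟨x, x⟩`. [textbook] -/
theorem sup_sq_le_two_dot (x : Fin 2 → ℝ) :
    1 / 2 * ‖x‖ ^ 2 ≤ x ⬝ᵥ ((1 : Matrix (Fin 2) (Fin 2) ℝ) *ᵥ x) := by
  have h0 : ‖x‖ ≤ |x 0| + |x 1| := by
    refine (pi_norm_le_iff_of_nonneg (by positivity)).2 fun i => ?_
    rw [Real.norm_eq_abs]
    fin_cases i
    · show |x 0| ≤ |x 0| + |x 1|
      linarith [abs_nonneg (x 1)]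
    · show |x 1| ≤ |x 0| + |x 1|
      linarith [abs_nonneg (x 0)]
  have h1 : ‖x‖ ^ 2 ≤ (|x 0| + |x 1|) ^ 2 := pow_le_pow_left₀ (norm_nonneg _) h0 2
  have h2 : (|x 0| + |x 1|) ^ 2 ≤ 2 * (x 0 * x 0 + x 1 * x 1) := by
    nlinarith [sq_abs (x 0), sq_abs (x 1), sq_nonneg (|x 0| - |x 1|)]
  simp only [Matrix.one_mulVec, dotProduct, Fin.sum_univ_two]
  nlinarith

/-- **A6 WITNESS OF THE ★★★ END** (director-ym STANDING A6 RULE №189 (3)):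
`slotAntiConcentration_restrict_of_projectedCentre_letterwise` APPLIED with EVERY binder discharged in the kernel —
exterior `X = Unit` under `dirac ()`, block `ℝ²`, kept cut `K = {|w₁| < 1}` (convex, reads no collar coordinate),
`A = 1` (symmetric, `½`-coercive for the sup norm), `P = 0` (`0`-Lipschitz), linear centre `m = 0`, dilation centre
`c = 0 ∈ K` (obtuse: the cross term vanishes; far: `2·0 ≤ ½‖·‖`), statistic `U = |w₁|` (`κ₀ = 1`, `θ = 1`, `ρ = ½`),
`C⋆ = univ`, ONE collar coordinate `0` with the letter `(−1, 1)` carried into `(−7∕6, 7∕6)` at odds `2c∕(1−c)`,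
`c = e∕3` (38m §1 `condOdds_keptCuts` on 38l §2's Gaussian species, the density identified by
`quadForm_one_eq_gaussian`); a satisfiability witness, not an estimate on Bałaban's measure. [textbook] -/
theorem collarJunctionProjectedCentre_binders_inhabited :
    SlotAntiConcentration
      ((((Measure.dirac ()).prod (volume : Measure (Fin 2 → ℝ))).withDensity
          fun p : Unit × (Fin 2 → ℝ) =>
            ({w : Fin 2 → ℝ | |w 1| < 1}).indicator (fun w => ENNReal.ofReal (Real.exp
              (-(1 / 2 * ((w - (0 : Fin 2 → ℝ)) ⬝ᵥ ((1 : Matrix (Fin 2) (Fin 2) ℝ) *ᵥ (w - 0))) + (0 : ℝ)))))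
              p.2).restrict
        ({p : Unit × (Fin 2 → ℝ) | |p.2 1| < 1} ∩
          (univ ∩ ⋂ i ∈ ({0} : Finset (Fin 2)), {q : Unit × (Fin 2 → ℝ) | q.2 i ∈ Ioo (-1 : ℝ) 1})))
      (fun p : Unit × (Fin 2 → ℝ) => |p.2 1|) 1 (1 / 2)
      (3 * ((Fintype.card (Fin 2) : ℝ) + 1) *
          (∏ _i ∈ ({0} : Finset (Fin 2)),
            (1 + 2 * (Real.exp 1 * 2 * ((7 : ℝ) / 6 - 1) / (1 - Real.exp 1 * 2 * ((7 : ℝ) / 6 - 1))))) /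
        (1 * (1 - 1 / 2))) := by
  haveI := isFiniteMeasure_blockGaussianWeight (κ := Fin 2)
  -- the density is 38m′'s Gaussian block weight under the same kept cut
  have hdens : (fun p : Unit × (Fin 2 → ℝ) =>
      ({w : Fin 2 → ℝ | |w 1| < 1}).indicator (fun w => ENNReal.ofReal (Real.exp
        (-(1 / 2 * ((w - (0 : Fin 2 → ℝ)) ⬝ᵥ ((1 : Matrix (Fin 2) (Fin 2) ℝ) *ᵥ (w - 0))) + (0 : ℝ))))) p.2)
      = fun p : Unit × (Fin 2 → ℝ) =>
        ({w : Fin 2 → ℝ | |w 1| < 1}).indicator (fun w => ENNReal.ofReal (Real.exp (-(∑ i, w i ^ 2 / 2)))) p.2 := by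
    funext p
    simp only [quadForm_one_eq_gaussian]
  have hA : Measurable fun p : Unit × (Fin 2 → ℝ) => ∑ i, p.2 i ^ 2 / 2 :=
    Finset.measurable_sum _ fun i _ => (((measurable_pi_apply i).comp measurable_snd).pow_const 2).div_const 2
  have hF : Measurable fun p : Unit × (Fin 2 → ℝ) => ENNReal.ofReal (Real.exp (-(∑ i, p.2 i ^ 2 / 2))) :=
    ENNReal.measurable_ofReal.comp (Real.measurable_exp.comp hA.neg)
  have hKhat : MeasurableSet {p : Unit × (Fin 2 → ℝ) | p.2 ∈ {w : Fin 2 → ℝ | |w 1| < 1}} :=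
    measurableSet_lt ((measurable_pi_apply 1).comp measurable_snd).abs measurable_const
  have hK1 : ∀ (_ : Unit) (w : Fin 2 → ℝ) (y : ℝ),
      update w 0 y ∈ {w : Fin 2 → ℝ | |w 1| < 1} ↔ w ∈ {w : Fin 2 → ℝ | |w 1| < 1} := by
    intro _ w y
    simp only [mem_setOf_eq, update_of_ne (show (1 : Fin 2) ≠ 0 by decide)]
  have hgG : Measurable fun p : Unit × (Fin 2 → ℝ) =>
      ({w : Fin 2 → ℝ | |w 1| < 1}).indicator (fun w => ENNReal.ofReal (Real.exp (-(∑ i, w i ^ 2 / 2)))) p.2 :=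
    measurable_fibreIndicator (fun _ : Unit => {w : Fin 2 → ℝ | |w 1| < 1}) hKhat
      (F := fun (_ : Unit) (w : Fin 2 → ℝ) => ENNReal.ofReal (Real.exp (-(∑ i, w i ^ 2 / 2)))) hF
  have hg : Measurable fun p : Unit × (Fin 2 → ℝ) =>
      ({w : Fin 2 → ℝ | |w 1| < 1}).indicator (fun w => ENNReal.ofReal (Real.exp
        (-(1 / 2 * ((w - (0 : Fin 2 → ℝ)) ⬝ᵥ ((1 : Matrix (Fin 2) (Fin 2) ℝ) *ᵥ (w - 0))) + (0 : ℝ))))) p.2 := by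
    rw [hdens]; exact hgG
  haveI : IsFiniteMeasure (((Measure.dirac ()).prod (volume : Measure (Fin 2 → ℝ))).withDensity
      fun p : Unit × (Fin 2 → ℝ) =>
        ({w : Fin 2 → ℝ | |w 1| < 1}).indicator (fun w => ENNReal.ofReal (Real.exp
          (-(1 / 2 * ((w - (0 : Fin 2 → ℝ)) ⬝ᵥ ((1 : Matrix (Fin 2) (Fin 2) ℝ) *ᵥ (w - 0))) + (0 : ℝ))))) p.2) := by
    rw [hdens, withDensity_fibreIndicator_eq_restrict _ (fun _ : Unit => {w : Fin 2 → ℝ | |w 1| < 1}) hKhat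
      (fun (_ : Unit) (w : Fin 2 → ℝ) => ENNReal.ofReal (Real.exp (-(∑ i, w i ^ 2 / 2))))]
    infer_instance
  have hU : Measurable fun p : Unit × (Fin 2 → ℝ) => |p.2 1| := ((measurable_pi_apply 1).comp measurable_snd).abs
  have he : Real.exp 1 * 2 * ((7 : ℝ) / 6 - 1) < 1 := by nlinarith [Real.exp_one_lt_d9]
  have hq0 : 0 ≤ 2 * (Real.exp 1 * 2 * ((7 : ℝ) / 6 - 1) / (1 - Real.exp 1 * 2 * ((7 : ℝ) / 6 - 1))) :=
    mul_nonneg zero_le_two (div_nonneg (by positivity) (sub_nonneg.2 he.le))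
  have hl01 : ∀ l ∈ Icc (1 - 1 / ((Fintype.card (Fin 2) : ℝ) + 1)) (1 : ℝ), 0 ≤ l ∧ l ≤ 1 := by
    intro l hl
    have h := hl.1
    simp only [Fintype.card_fin, Nat.cast_ofNat] at h
    exact ⟨by linarith, hl.2⟩
  -- the kept cut ∕ core fibre `{|w₁| < 1}` is convex (two half-spaces of the linear form `w ↦ w 1`)
  have hslab : Convex ℝ {w : Fin 2 → ℝ | |w 1| < 1} := by
    have hlin : IsLinearMap ℝ fun w : Fin 2 → ℝ => w 1 := ⟨fun _ _ => rfl, fun _ _ => rfl⟩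
    have hset : {w : Fin 2 → ℝ | |w 1| < 1} = {w : Fin 2 → ℝ | -1 < w 1} ∩ {w | w 1 < 1} := by
      ext w
      simp only [mem_setOf_eq, mem_inter_iff, abs_lt]
    rw [hset]
    exact (convex_halfSpace_gt hlin (-1)).inter (convex_halfSpace_lt hlin 1)
  refine slotAntiConcentration_restrict_of_projectedCentre_letterwise (Measure.dirac ())
    (fun _ => {w : Fin 2 → ℝ | |w 1| < 1}) 1 Matrix.isSymm_one (γ := 1 / 2) (G := 0) (by norm_num)
    sup_sq_le_two_dot (fun _ => 0) (c := fun _ => 0) measurable_const (fun _ _ => 0) hg hU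
    MeasurableSet.univ {0} (fun _ => Ioo (-1 : ℝ) 1) (fun _ => Ioo (-(7 / 6) : ℝ) (7 / 6))
    (fun _ _ => measurableSet_Ioo) (fun _ _ => measurableSet_Ioo)
    (fun _ _ => Ioo_subset_Ioo (by norm_num) (by norm_num)) _ (fun _ _ => hq0) ?_ ?_ (fun _ _ _ _ _ => by simp)
    one_pos (by norm_num) (by norm_num) one_pos (fun _ => hslab) ?_ ?_ ?_ ?_ ?_ ?_ ?_
  · -- hodds: identify the density, then 38m §1 under the cut on 38l §2's Gaussian species
    intro i hi C hC hCi
    rw [Finset.mem_singleton] at hi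
    subst hi
    rw [hdens]
    exact condOdds_keptCuts ((Measure.dirac ()).prod volume) (fun _ : Unit => {w : Fin 2 → ℝ | |w 1| < 1}) hKhat
      (fun (_ : Unit) (w : Fin 2 → ℝ) => ENNReal.ofReal (Real.exp (-(∑ i, w i ^ 2 / 2)))) hK1
      measurableSet_Ioo measurableSet_Ioo
      (fun C hC hCi => hodds_absLetter_of_partialSlopes (Measure.dirac ()) hA 0 (by norm_num) (by norm_num)
        (by norm_num) he (gaussianBlock_inwardSlopes 0).1 (gaussianBlock_inwardSlopes 0).2 C hC hCi) C hC hCi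
  · -- the slot statistic reads no collar coordinate
    intro i hi z w y
    rw [Finset.mem_singleton] at hi
    subst hi
    show |update w 0 y 1| = |w 1|
    rw [update_of_ne (by decide)]
  · -- the dilation centre lies in the kept cut
    intro _
    show |(0 : Fin 2 → ℝ) 1| < 1
    simp
  · -- `P = 0` is `0`-Lipschitz
    intro _ v _ v' _
    simp
  · -- hobt: the cross term about `c = m = 0` vanishes
    intro p _ _ _ _
    simp
  · -- hfar: `2·0 ≤ ½‖·‖`
    intro p _ _ _ _
    simp only [mul_zero]
    positivity
  · -- hletter: the kept letter on coordinate `0` is carried into itself ⊂ the relaxed letter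
    intro i hi l hl z w hw
    rw [Finset.mem_singleton] at hi
    subst hi
    obtain ⟨hl0, hl1⟩ := hl01 l hl
    simp only [Pi.add_apply, Pi.zero_apply, Pi.smul_apply, smul_eq_mul, sub_zero, zero_add, mem_Ioo] at hw ⊢
    constructor
    · nlinarith [mul_nonneg hl0 (show (0 : ℝ) ≤ w 0 + 1 by linarith [hw.1])]
    · nlinarith [mul_nonneg hl0 (show (0 : ℝ) ≤ 1 - w 0 by linarith [hw.2])]
  · -- hcore: the core fibre `{|w₁| < 1}` is convex and contains the centre (38m §2 `hcore_of_starConvex`)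
    have hl₀ : (0 : ℝ) ≤ 1 - 1 / ((Fintype.card (Fin 2) : ℝ) + 1) := by
      simp only [Fintype.card_fin, Nat.cast_ofNat]
      norm_num
    refine hcore_of_starConvex (fun _ => (0 : Fin 2 → ℝ)) (fun p : Unit × (Fin 2 → ℝ) => |p.2 1|) univ hl₀ ?_
    intro p _ _ _
    show StarConvex ℝ (0 : Fin 2 → ℝ)
      {w : Fin 2 → ℝ | |w 1| < 1 ∧ ((p.1, w) : Unit × (Fin 2 → ℝ)) ∈ (univ : Set (Unit × (Fin 2 → ℝ)))}
    have hset : {w : Fin 2 → ℝ | |w 1| < 1 ∧ ((p.1, w) : Unit × (Fin 2 → ℝ)) ∈ (univ : Set (Unit × (Fin 2 → ℝ)))}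
        = {w : Fin 2 → ℝ | |w 1| < 1} := by
      ext w
      simp only [mem_setOf_eq, mem_univ, and_true]
    rw [hset]
    exact hslab.starConvex (by simp)
  · -- hRT: `U = |w₁|` is radially transversal with `κ₀ = 1` on `{½ ≤ U}`
    intro p h1 _ _ s hs _ _ _
    have h1' : 1 / 2 ≤ |p.2 1| := by have h := h1; norm_num at h; exact h
    simp only [zero_add, sub_zero, Pi.smul_apply, smul_eq_mul]
    rw [abs_mul, abs_of_nonneg (by linarith : (0 : ℝ) ≤ s)]
    nlinarith [mul_nonneg (show (0 : ℝ) ≤ s - 1 by linarith) (show (0 : ℝ) ≤ |p.2 1| - 1 / 2 by linarith)]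

end Witness

end Summit.QuantumFields.YangMills.Theorems.N21CollarJunctionProjectedCentre
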